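import Mathlib
import HarnessLib

/-!
# The LINEAR CORE of the `a = 0` (CLM-point) profile equation on the NS-type line, part 1:
# first integral and the integrating-factor tail bound `ξ²|Ω(ξ)| ≤ (2/c)∫_ξ^∞|ηhΩ|`

HONEST FRAMING (cell ns-blowup GROUP B «PROFILE SEARCH», zone Z3 = the 1-D viscous gCLM/OSW sheet; human rulings
D-0035/D-0074): **one-variable real analysis about a LINEAR second-order ODE on `(0,∞)` with a continuous coefficient;
1-D MODEL bookkeeping; not Euler, not Navier–Stokes; «violates: none — MODEL».** Nothing here is a statement about NS.

THE POINT. At the CLM point `a = 0` of the gCLM/OSW sheet the velocity term `a𝒰Ω′` of the profile equation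
`F₁ = c_ωΩ + c_lξΩ′ + a𝒰Ω′ − (HΩ)Ω − εΩ″ ≡ 0` is absent, so GIVEN the stretching coefficient `h := HΩ` the equation on the
NS-type line `c_l = c/2` (`c = c_ω`) is the LINEAR equation `εΩ″ = (c − h(ξ))Ω + (c/2)ξΩ′`. This file proves, for an ABSTRACT
continuous coefficient `h` (the genuine `HΩ` is plugged in by `SheetNSLineCLMPointEmpty.lean`):
* `linearCore_first_integral` — the exact first integral: with `I(ξ) := ∫_ξ^∞ η h(η)Ω(η) dη`,
  `ε(ξΩ′(ξ) − Ω(ξ)) = (c/2)ξ²Ω(ξ) + I(ξ)` for every `ξ > 0`, for solutions with `Ω → 0`, `ξΩ′ → 0`, `ξ²Ω → 0` at `+∞`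
  (`G := ξ²Ω − (2ε/c)(ξΩ′ − Ω)` has `G′ = (2/c)ξhΩ` and `G(∞) = 0`);
* `linearCore_sq_mul_abs_le` — the integrating factor `ξ⁻¹e^{−cξ²/(4ε)}` and the Gaussian tail bound
  `∫_ξ^∞η⁻²e^{−bη²} ≤ e^{−bξ²}/(2bξ³)` give **`ξ²|Ω(ξ)| ≤ (2/c)·T(ξ)`, `T(ξ) := ∫_ξ^∞ |η h(η)Ω(η)| dη`**, for every `ξ > 0`.
Part 2 (`SheetNSLineLinearCore.lean`) concludes `Ω ≡ 0` on `(0,∞)` when moreover `h ∈ L²(ℝ)`. All proofs are elementary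
(product rule, `∫_ξ^∞` of an exact derivative); tagged [new here — MODEL bookkeeping] / [folklore]. No definitions, no
`def … : Prop` hypotheses, standard axioms.
bears_on: LADDER-NS N5 / zone Z3 row Z3-E12⁻ clause (i′) «the Schochet corner a = 0 is the divide» (CENSUS-Z3 v2.12 §0) → N1 linear
core. WHAT THIS IS NOT: not NS; not an existence statement; nothing about `a ≠ 0`.
-/

noncomputable section
open Set Filter Topology MeasureTheory
open scoped Real

namespace Summit.NavierStokesRegularity.OSWSelfSimilar
namespace SheetHalfLine

/-! ### Two Gaussian-type tail integrals -/

/-- `∫_ξ^∞ η⁻² dη = ξ⁻¹` for `ξ > 0` (as `(η²)⁻¹`), with integrability. [folklore] -/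
theorem linearCore_integral_Ioi_inv_sq {ξ : ℝ} (hξ : 0 < ξ) :
    IntegrableOn (fun η : ℝ => (η ^ 2)⁻¹) (Ioi ξ) ∧ ∫ η in Ioi ξ, (η ^ 2)⁻¹ = ξ⁻¹ := by
  have hderiv : ∀ η ∈ Ioi ξ, HasDerivAt (fun η : ℝ => -η⁻¹) ((η ^ 2)⁻¹) η := by
    intro η hη
    have hη0 : η ≠ 0 := ne_of_gt (hξ.trans hη)
    exact ((hasDerivAt_inv hη0).fun_neg).congr_deriv (by simp)
  have hcont : ContinuousWithinAt (fun η : ℝ => -η⁻¹) (Ici ξ) ξ :=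
    ((continuousAt_inv₀ hξ.ne').neg).continuousWithinAt
  have hlim : Tendsto (fun η : ℝ => -η⁻¹) atTop (𝓝 0) := by
    have h : Tendsto (fun η : ℝ => η⁻¹) atTop (𝓝 0) := tendsto_inv_atTop_zero
    simpa using h.neg
  have hnn : ∀ η ∈ Ioi ξ, 0 ≤ (η ^ 2)⁻¹ := fun η _ => by positivity
  refine ⟨integrableOn_Ioi_deriv_of_nonneg hcont hderiv hnn hlim, ?_⟩
  rw [integral_Ioi_of_hasDerivAt_of_tendsto hcont hderiv (integrableOn_Ioi_deriv_of_nonneg hcont hderiv hnn hlim) hlim]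
  simp

/-- `∫_ξ^∞ (η/ξ³)e^{−bη²} dη = e^{−bξ²}/(2bξ³)` for `ξ, b > 0`, with integrability. [folklore] -/
theorem linearCore_integral_Ioi_mul_exp_neg_sq {ξ b : ℝ} (hξ : 0 < ξ) (hb : 0 < b) :
    IntegrableOn (fun η : ℝ => η / ξ ^ 3 * Real.exp (-b * η ^ 2)) (Ioi ξ) ∧
      ∫ η in Ioi ξ, η / ξ ^ 3 * Real.exp (-b * η ^ 2) = Real.exp (-b * ξ ^ 2) / (2 * b * ξ ^ 3) := by
  have hξ3 : 0 < ξ ^ 3 := by positivity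
  have hderiv : ∀ η ∈ Ioi ξ, HasDerivAt (fun η : ℝ => -Real.exp (-b * η ^ 2) / (2 * b * ξ ^ 3))
      (η / ξ ^ 3 * Real.exp (-b * η ^ 2)) η := by
    intro η _
    have h1 : HasDerivAt (fun η : ℝ => -b * η ^ 2) (-b * (2 * η)) η := by
      simpa using (hasDerivAt_pow 2 η).const_mul (-b)
    have hb0 : b ≠ 0 := hb.ne'
    have hξ0 : ξ ^ 3 ≠ 0 := hξ3.ne'
    refine (h1.exp.fun_neg.div_const (2 * b * ξ ^ 3)).congr_deriv ?_
    field_simp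
  have hcont : ContinuousWithinAt (fun η : ℝ => -Real.exp (-b * η ^ 2) / (2 * b * ξ ^ 3)) (Ici ξ) ξ := by
    fun_prop
  have hlim : Tendsto (fun η : ℝ => -Real.exp (-b * η ^ 2) / (2 * b * ξ ^ 3)) atTop (𝓝 0) := by
    have h1 : Tendsto (fun η : ℝ => -b * η ^ 2) atTop atBot := by
      have := (tendsto_pow_atTop (n := 2) (α := ℝ) two_ne_zero).const_mul_atTop_of_neg (neg_lt_zero.mpr hb)
      simpa using this
    have h2 : Tendsto (fun η : ℝ => Real.exp (-b * η ^ 2)) atTop (𝓝 0) := Real.tendsto_exp_atBot.comp h1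
    have h3 := (h2.neg).div_const (2 * b * ξ ^ 3)
    simpa using h3
  have hnn : ∀ η ∈ Ioi ξ, 0 ≤ η / ξ ^ 3 * Real.exp (-b * η ^ 2) := fun η hη => by
    have : 0 ≤ η := (hξ.trans hη).le
    positivity
  have hint := integrableOn_Ioi_deriv_of_nonneg hcont hderiv hnn hlim
  refine ⟨hint, ?_⟩
  rw [integral_Ioi_of_hasDerivAt_of_tendsto hcont hderiv hint hlim]
  ring

/-- The Gaussian tail bound used with the integrating factor: for `ξ, b > 0`,
`∫_ξ^∞ η⁻² e^{−bη²} dη ≤ e^{−bξ²}/(2bξ³)` (compare `η⁻² ≤ η/ξ³` on `η ≥ ξ`), with integrability. [folklore] -/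
theorem linearCore_integral_Ioi_inv_sq_mul_exp_le {ξ b : ℝ} (hξ : 0 < ξ) (hb : 0 < b) :
    IntegrableOn (fun η : ℝ => (η ^ 2)⁻¹ * Real.exp (-b * η ^ 2)) (Ioi ξ) ∧
      ∫ η in Ioi ξ, (η ^ 2)⁻¹ * Real.exp (-b * η ^ 2) ≤ Real.exp (-b * ξ ^ 2) / (2 * b * ξ ^ 3) := by
  obtain ⟨hI, hval⟩ := linearCore_integral_Ioi_mul_exp_neg_sq hξ hb
  have hle : ∀ η ∈ Ioi ξ, (η ^ 2)⁻¹ * Real.exp (-b * η ^ 2) ≤ η / ξ ^ 3 * Real.exp (-b * η ^ 2) := by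
    intro η hη
    have hη : ξ < η := hη
    have hη0 : 0 < η := hξ.trans hη
    apply mul_le_mul_of_nonneg_right _ (Real.exp_pos _).le
    rw [inv_le_iff_one_le_mul₀ (by positivity), div_mul_eq_mul_div, one_le_div (by positivity)]
    have : ξ ^ 3 ≤ η ^ 3 := by gcongr
    nlinarith
  have hmeas : AEStronglyMeasurable (fun η : ℝ => (η ^ 2)⁻¹ * Real.exp (-b * η ^ 2)) (volume.restrict (Ioi ξ)) := by
    have : Measurable (fun η : ℝ => (η ^ 2)⁻¹ * Real.exp (-b * η ^ 2)) := by fun_prop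
    exact this.aestronglyMeasurable
  have hint : IntegrableOn (fun η : ℝ => (η ^ 2)⁻¹ * Real.exp (-b * η ^ 2)) (Ioi ξ) := by
    refine Integrable.mono' hI hmeas ?_
    filter_upwards [self_mem_ae_restrict measurableSet_Ioi] with η hη
    rw [Real.norm_eq_abs, abs_of_nonneg (by positivity)]
    exact hle η hη
  exact ⟨hint, hval ▸ setIntegral_mono_on hint hI measurableSet_Ioi hle⟩

/-! ### Tail integrals of a continuous function integrable on `(0,∞)` -/

/-- For `f` continuous on `ℝ` and integrable on `(0,∞)`, the tail integral `η ↦ ∫_η^∞ f` is continuous on `[0,∞)`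
(it equals `∫_0^∞ f − ∫_0^η f`). [folklore] -/
theorem linearCore_continuousOn_tailIntegral {f : ℝ → ℝ} (hfc : Continuous f) (hfi : IntegrableOn f (Ioi 0)) :
    ContinuousOn (fun η => ∫ s in Ioi η, f s) (Ici 0) := by
  have hrepr : EqOn (fun η => ∫ s in Ioi η, f s) (fun η => (∫ s in Ioi 0, f s) - ∫ s in (0:ℝ)..η, f s) (Ici 0) := by
    intro η hη
    have h := intervalIntegral.integral_Ioi_sub_Ioi hfi hη
    simp only
    linarith
  have hP : Continuous (fun u => ∫ s in (0:ℝ)..u, f s) :=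
    intervalIntegral.continuous_primitive (fun a b => hfc.intervalIntegrable a b) 0
  exact (continuous_const.sub hP).continuousOn.congr hrepr

/-- Tail integrals are bounded by the tail integral of the absolute value from any earlier point:
`|∫_η^∞ f| ≤ ∫_ξ^∞ |f|` for `ξ ≤ η` (`f` integrable on `(ξ,∞)`). [folklore] -/
theorem linearCore_abs_tailIntegral_le {f : ℝ → ℝ} {ξ η : ℝ} (hfi : IntegrableOn f (Ioi ξ)) (hξη : ξ ≤ η) :
    |∫ s in Ioi η, f s| ≤ ∫ s in Ioi ξ, |f s| := by
  have h1 : |∫ s in Ioi η, f s| ≤ ∫ s in Ioi η, |f s| := by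
    have := norm_integral_le_integral_norm (μ := volume.restrict (Ioi η)) f
    simpa only [Real.norm_eq_abs] using this
  refine h1.trans ?_
  exact setIntegral_mono_set hfi.abs (ae_of_all _ fun s => abs_nonneg _) (ae_of_all _ (Ioi_subset_Ioi hξη))

/-! ### Step 1: the exact first integral of the linear core -/

/-- **FIRST INTEGRAL of the `a = 0` linear core.** If `εΩ″ = cΩ + (c/2)ξΩ′ − hΩ` on `(0,∞)` (`c ≠ 0`), `ξhΩ ∈ L¹(0,∞)`, and
`Ω → 0`, `ξΩ′ → 0`, `ξ²Ω → 0` at `+∞`, then for every `ξ > 0`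
`ε(ξΩ′(ξ) − Ω(ξ)) = (c/2)ξ²Ω(ξ) + ∫_ξ^∞ η h(η)Ω(η) dη`
(`G := ξ²Ω − (2ε/c)(ξΩ′ − Ω)` has `G′ = (2/c)ξhΩ` and `G(∞) = 0`). [new here — MODEL bookkeeping] -/
theorem linearCore_first_integral {c ε : ℝ} {h Om dOm ddOm : ℝ → ℝ} (hc : c ≠ 0)
    (hOm : ∀ ξ, HasDerivAt Om (dOm ξ) ξ) (hdOm : ∀ ξ, HasDerivAt dOm (ddOm ξ) ξ)
    (heq : ∀ ξ ∈ Ioi (0:ℝ), ε * ddOm ξ = c * Om ξ + c / 2 * ξ * dOm ξ - h ξ * Om ξ)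
    (iH : IntegrableOn (fun ξ => ξ * (h ξ * Om ξ)) (Ioi 0))
    (hOm0 : Tendsto Om atTop (𝓝 0)) (hdOm1 : Tendsto (fun R => R * dOm R) atTop (𝓝 0))
    (htail : Tendsto (fun R => R ^ 2 * Om R) atTop (𝓝 0)) {ξ : ℝ} (hξ : 0 < ξ) :
    ε * (ξ * dOm ξ - Om ξ) = c / 2 * (ξ ^ 2 * Om ξ) + ∫ η in Ioi ξ, η * (h η * Om η) := by
  -- the function `G` and its derivative
  have hsq : ∀ η : ℝ, HasDerivAt (fun x : ℝ => x ^ 2) (2 * η) η := fun η => by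
    simpa using hasDerivAt_pow 2 η
  have hG : ∀ η : ℝ, HasDerivAt (fun x => x ^ 2 * Om x - 2 * ε / c * (x * dOm x - Om x))
      (2 * η * Om η + η ^ 2 * dOm η - 2 * ε / c * (1 * dOm η + η * ddOm η - dOm η)) η := by
    intro η
    have h1 := (hsq η).fun_mul (hOm η)
    have h2 := (((hasDerivAt_id' η).fun_mul (hdOm η)).fun_sub (hOm η)).const_mul (2 * ε / c)
    exact h1.fun_sub h2
  have hG' : ∀ η ∈ Ioi ξ, HasDerivAt (fun x => x ^ 2 * Om x - 2 * ε / c * (x * dOm x - Om x))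
      (2 / c * (η * (h η * Om η))) η := by
    intro η hη
    have hη0 : η ∈ Ioi (0:ℝ) := hξ.trans hη
    refine (hG η).congr_deriv ?_
    have e := heq η hη0
    field_simp
    linear_combination (-(2 * η)) * e
  have hcont : ContinuousWithinAt (fun x => x ^ 2 * Om x - 2 * ε / c * (x * dOm x - Om x)) (Ici ξ) ξ :=
    (hG ξ).continuousAt.continuousWithinAt
  have hint : IntegrableOn (fun η => 2 / c * (η * (h η * Om η))) (Ioi ξ) :=
    (iH.mono_set (Ioi_subset_Ioi hξ.le)).const_mul (2 / c)
  have hlim : Tendsto (fun x => x ^ 2 * Om x - 2 * ε / c * (x * dOm x - Om x)) atTop (𝓝 0) := by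
    have := htail.sub ((hdOm1.sub hOm0).const_mul (2 * ε / c))
    simpa using this
  have key := integral_Ioi_of_hasDerivAt_of_tendsto hcont hG' hint hlim
  rw [integral_const_mul] at key
  have hX : ∫ η in Ioi ξ, η * (h η * Om η) = c / 2 * (0 - (ξ ^ 2 * Om ξ - 2 * ε / c * (ξ * dOm ξ - Om ξ))) := by
    have h2c : (2 / c : ℝ) ≠ 0 := div_ne_zero two_ne_zero hc
    apply mul_left_cancel₀ h2c
    rw [key]
    field_simp
  rw [hX]
  field_simp
  ring

/-! ### Step 2: the pointwise bound from the integrating factor `ξ⁻¹e^{−cξ²/(4ε)}` -/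

/-- **POINTWISE TAIL BOUND of the `a = 0` linear core.** In the setting of `linearCore_first_integral` with `c, ε > 0` and
`h` continuous: **`ξ²|Ω(ξ)| ≤ (2/c)·∫_ξ^∞ |η h(η)Ω(η)| dη`** for every `ξ > 0`. Proof: `Φ := ξ⁻¹e^{−cξ²/(4ε)}Ω` has
`Φ′ = ξ⁻¹e^{−cξ²/(4ε)}·I(ξ)/(εξ)` with `I(ξ) = ∫_ξ^∞ηhΩ` (first integral), `Φ(∞) = 0`, so `|Φ(ξ)| ≤ (T(ξ)/ε)∫_ξ^∞η⁻²e^{−cη²/(4ε)}`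
`≤ (T(ξ)/ε)·e^{−cξ²/(4ε)}·(2ε/(cξ³))`. [new here — MODEL bookkeeping] -/
theorem linearCore_sq_mul_abs_le {c ε : ℝ} {h Om dOm ddOm : ℝ → ℝ} (hc : 0 < c) (hε : 0 < ε) (hh : Continuous h)
    (hOm : ∀ ξ, HasDerivAt Om (dOm ξ) ξ) (hdOm : ∀ ξ, HasDerivAt dOm (ddOm ξ) ξ)
    (heq : ∀ ξ ∈ Ioi (0:ℝ), ε * ddOm ξ = c * Om ξ + c / 2 * ξ * dOm ξ - h ξ * Om ξ)
    (iH : IntegrableOn (fun ξ => ξ * (h ξ * Om ξ)) (Ioi 0))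
    (hOm0 : Tendsto Om atTop (𝓝 0)) (hdOm1 : Tendsto (fun R => R * dOm R) atTop (𝓝 0))
    (htail : Tendsto (fun R => R ^ 2 * Om R) atTop (𝓝 0)) {ξ : ℝ} (hξ : 0 < ξ) :
    ξ ^ 2 * |Om ξ| ≤ 2 / c * ∫ η in Ioi ξ, |η * (h η * Om η)| := by
  have hc0 : c ≠ 0 := hc.ne'
  have hcΩ : Continuous Om := continuous_iff_continuousAt.mpr fun x => (hOm x).continuousAt
  -- the tail integral `I`, its continuity on `[0,∞)` and the uniform bound `|I η| ≤ T` on `[ξ,∞)`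
  set T : ℝ := ∫ η in Ioi ξ, |η * (h η * Om η)| with hT
  have hT0 : 0 ≤ T := setIntegral_nonneg measurableSet_Ioi fun η _ => abs_nonneg _
  have hfc : Continuous (fun η => η * (h η * Om η)) := continuous_id.mul (hh.mul hcΩ)
  have hIcont : ContinuousOn (fun η => ∫ s in Ioi η, s * (h s * Om s)) (Ici 0) := linearCore_continuousOn_tailIntegral hfc iH
  have hIle : ∀ η ∈ Ioi ξ, |∫ s in Ioi η, s * (h s * Om s)| ≤ T :=
    fun η hη => linearCore_abs_tailIntegral_le (iH.mono_set (Ioi_subset_Ioi hξ.le)) (le_of_lt hη)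
  -- the integrating factor
  set b : ℝ := c / (4 * ε) with hb
  have hb0 : 0 < b := by positivity
  have hexp : ∀ η : ℝ, HasDerivAt (fun x : ℝ => Real.exp (-b * x ^ 2)) (Real.exp (-b * η ^ 2) * (-b * (2 * η))) η :=
    fun η => by
      have h1 : HasDerivAt (fun x : ℝ => -b * x ^ 2) (-b * (2 * η)) η := by
        simpa using (hasDerivAt_pow 2 η).const_mul (-b)
      exact h1.exp
  -- `Φ = ξ⁻¹ e^{-bξ²} Ω` and its derivative on `(0,∞)`
  have hΦ : ∀ η ∈ Ioi ξ, HasDerivAt (fun x => x⁻¹ * Real.exp (-b * x ^ 2) * Om x)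
      (η⁻¹ * Real.exp (-b * η ^ 2) / (ε * η) * ∫ s in Ioi η, s * (h s * Om s)) η := by
    intro η hη
    have hη0 : 0 < η := hξ.trans hη
    have hμ := ((hasDerivAt_inv hη0.ne').fun_mul (hexp η)).fun_mul (hOm η)
    refine hμ.congr_deriv ?_
    have hfi := linearCore_first_integral hc0 hOm hdOm heq iH hOm0 hdOm1 htail hη0
    have hI : ∫ s in Ioi η, s * (h s * Om s) = ε * (η * dOm η - Om η) - c / 2 * (η ^ 2 * Om η) := by linarith
    rw [hI, hb]
    field_simp
    ring
  -- integrability of `Φ′` on `(ξ,∞)`: dominated by `(T/ε)·η⁻²e^{-bη²}`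
  obtain ⟨hdomI, hdomle⟩ := linearCore_integral_Ioi_inv_sq_mul_exp_le hξ hb0
  have hΦ'meas : AEStronglyMeasurable (fun η => η⁻¹ * Real.exp (-b * η ^ 2) / (ε * η) * ∫ s in Ioi η, s * (h s * Om s))
      (volume.restrict (Ioi ξ)) := by
    refine ContinuousOn.aestronglyMeasurable ?_ measurableSet_Ioi
    refine ContinuousOn.mul ?_ (hIcont.mono fun η hη => (hξ.trans hη).le)
    refine continuousOn_of_forall_continuousAt fun η hη => ?_
    have hη0 : η ≠ 0 := (hξ.trans hη).ne'
    have hεη : ε * η ≠ 0 := mul_ne_zero hε.ne' hη0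
    fun_prop (disch := assumption)
  have hΦ'int : IntegrableOn (fun η => η⁻¹ * Real.exp (-b * η ^ 2) / (ε * η) * ∫ s in Ioi η, s * (h s * Om s)) (Ioi ξ) := by
    refine Integrable.mono' (hdomI.const_mul (T / ε)) hΦ'meas ?_
    filter_upwards [self_mem_ae_restrict measurableSet_Ioi] with η hη
    have hη0 : 0 < η := hξ.trans hη
    rw [Real.norm_eq_abs, abs_mul, abs_of_nonneg (by positivity)]
    calc η⁻¹ * Real.exp (-b * η ^ 2) / (ε * η) * |∫ s in Ioi η, s * (h s * Om s)|
        ≤ η⁻¹ * Real.exp (-b * η ^ 2) / (ε * η) * T :=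
          mul_le_mul_of_nonneg_left (hIle η hη) (by positivity)
      _ = T / ε * ((η ^ 2)⁻¹ * Real.exp (-b * η ^ 2)) := by field_simp
  -- `Φ → 0` and `Φ` continuous at `ξ`
  have hΦlim : Tendsto (fun x : ℝ => x⁻¹ * Real.exp (-b * x ^ 2) * Om x) atTop (𝓝 0) := by
    have h1 : Tendsto (fun η : ℝ => -b * η ^ 2) atTop atBot := by
      have := (tendsto_pow_atTop (n := 2) (α := ℝ) two_ne_zero).const_mul_atTop_of_neg (neg_lt_zero.mpr hb0)
      simpa using this
    have h2 : Tendsto (fun η : ℝ => Real.exp (-b * η ^ 2)) atTop (𝓝 0) := Real.tendsto_exp_atBot.comp h1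
    have h3 : Tendsto (fun η : ℝ => η⁻¹) atTop (𝓝 0) := tendsto_inv_atTop_zero
    simpa using (h3.mul h2).mul hOm0
  have hΦcont : ContinuousWithinAt (fun x : ℝ => x⁻¹ * Real.exp (-b * x ^ 2) * Om x) (Ici ξ) ξ := by
    have := ((hasDerivAt_inv hξ.ne').fun_mul (hexp ξ)).fun_mul (hOm ξ)
    exact this.continuousAt.continuousWithinAt
  -- integrate `Φ′` over `(ξ,∞)`
  have key := integral_Ioi_of_hasDerivAt_of_tendsto hΦcont hΦ hΦ'int hΦlim
  have hval : ξ⁻¹ * Real.exp (-b * ξ ^ 2) * Om ξ =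
      -∫ η in Ioi ξ, η⁻¹ * Real.exp (-b * η ^ 2) / (ε * η) * ∫ s in Ioi η, s * (h s * Om s) := by linarith
  have hbound : |ξ⁻¹ * Real.exp (-b * ξ ^ 2) * Om ξ| ≤ T / ε * (Real.exp (-b * ξ ^ 2) / (2 * b * ξ ^ 3)) := by
    rw [hval, abs_neg]
    have h1 : |∫ η in Ioi ξ, η⁻¹ * Real.exp (-b * η ^ 2) / (ε * η) * ∫ s in Ioi η, s * (h s * Om s)|
        ≤ ∫ η in Ioi ξ, T / ε * ((η ^ 2)⁻¹ * Real.exp (-b * η ^ 2)) := by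
      have hn := norm_integral_le_integral_norm (μ := volume.restrict (Ioi ξ))
        (fun η => η⁻¹ * Real.exp (-b * η ^ 2) / (ε * η) * ∫ s in Ioi η, s * (h s * Om s))
      rw [Real.norm_eq_abs] at hn
      refine hn.trans (setIntegral_mono_on hΦ'int.norm (hdomI.const_mul (T / ε)) measurableSet_Ioi fun η hη => ?_)
      have hη0 : 0 < η := hξ.trans hη
      rw [Real.norm_eq_abs, abs_mul, abs_of_nonneg (by positivity)]
      calc η⁻¹ * Real.exp (-b * η ^ 2) / (ε * η) * |∫ s in Ioi η, s * (h s * Om s)|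
          ≤ η⁻¹ * Real.exp (-b * η ^ 2) / (ε * η) * T :=
            mul_le_mul_of_nonneg_left (hIle η hη) (by positivity)
        _ = T / ε * ((η ^ 2)⁻¹ * Real.exp (-b * η ^ 2)) := by field_simp
    refine h1.trans ?_
    rw [integral_const_mul]
    exact mul_le_mul_of_nonneg_left hdomle (by positivity)
  -- unwind the integrating factor
  have hE : 0 < Real.exp (-b * ξ ^ 2) := Real.exp_pos _
  rw [abs_mul, abs_of_nonneg (by positivity)] at hbound
  have h2 : |Om ξ| ≤ T / (2 * b * ε * ξ ^ 2) := by
    have h3 : |Om ξ| * (ξ⁻¹ * Real.exp (-b * ξ ^ 2)) ≤ T / (2 * b * ε * ξ ^ 2) * (ξ⁻¹ * Real.exp (-b * ξ ^ 2)) := by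
      calc |Om ξ| * (ξ⁻¹ * Real.exp (-b * ξ ^ 2)) = ξ⁻¹ * Real.exp (-b * ξ ^ 2) * |Om ξ| := by ring
        _ ≤ T / ε * (Real.exp (-b * ξ ^ 2) / (2 * b * ξ ^ 3)) := hbound
        _ = T / (2 * b * ε * ξ ^ 2) * (ξ⁻¹ * Real.exp (-b * ξ ^ 2)) := by field_simp
    exact le_of_mul_le_mul_right h3 (by positivity)
  calc ξ ^ 2 * |Om ξ| ≤ ξ ^ 2 * (T / (2 * b * ε * ξ ^ 2)) := mul_le_mul_of_nonneg_left h2 (by positivity)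
    _ = 2 / c * T := by rw [hb]; field_simp; ring

end SheetHalfLine
end Summit.NavierStokesRegularity.OSWSelfSimilar
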